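import Literature.Analysis.FluidPDE.CarlemanFirstWeight
import Literature.Analysis.FluidPDE.BackwardHeatCaccioppoli
import HarnessLib

/-!
# Unique continuation across spatial boundaries, I: parabolic dilations and weight bounds

Analysis/FluidPDE support file (everything proved, no definitions) on the discharge path of the
named fact `Literature.Analysis.FluidPDE.ess_unique_continuation` (`NSLerayHopfProofs.lean`;
Escauriaza–Seregin–Šverák 2003, Thm. 4.1 = Seregin 2014, App. A.2, Thm. 2.4 with Lemma A.1).
The proof of Lemma A.1 rescales the solution `u` of the backward heat inequality around the
origin, `v(y, s) = u(λy, λ²s)`, `λ = √(2t)`, applies the first Carleman inequality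
(Seregin 2014, Prop. 1.2; proved in the tree, `Carleman.carleman_inequality_first_of_contDiff_two`)
to a cut-off of `v`, and estimates the Carleman weight `h^{-2a}(s) e^{-|y|²/4s}`,
`h(s) = s e^{(1-s)/3}`, on the various regions of the cut-off. This file supplies

* the calculus of the **parabolic dilation** `w ↦ U(λ² w.1, x₁ + λ w.2)` of a function `U` that
  is `C²` on an open set only (uncurried frame operators `dt`, `dx`, `lap`, `gradSq` of
  `CarlemanCalculus.lean`): `∂ₜ(U ∘ A) = λ² (∂ₜU) ∘ A`, `∂ₑ(U ∘ A) = λ (∂ₑU) ∘ A`,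
  `Δ(U ∘ A) = λ² (ΔU) ∘ A`, `|∇(U ∘ A)|² = λ² |∇U|² ∘ A`, and the transfer of the inequality
  `|∂ₜU + ΔU| ≤ c(|U| + |∇U|)` to `U ∘ A` with constant `cλ` for `0 < λ ≤ 1` (Seregin 2014,
  (A.2.5));
* elementary properties of `h`: `h(1) = 1`, `h` is nondecreasing on `[0, 3]`, `s ≤ h(s) ≤ 1` on
  `[0, 1]`, `1 < h(3/2) < e` (so that `0 < log h(3/2) < 1`, Seregin 2014, (A.2.13): "this is
  legal, since `h(3/2) > 1`");
* pointwise bounds for the Carleman weight `carlemanWeight a (s, y) = h(s)^{-2a} e^{-|y|²/4s}`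
  on the regions met in the proof of Lemma A.1 ((A.2.11)–(A.2.16)): the top `3/2 ≤ s`, the
  annulus `|y| ≥ ρ/2`, the initial layer `s ≤ 1`, and from below on `1/2 ≤ s ≤ 1`;
* three elementary real inequalities: `s^{-p} e^{-c/s} ≤ e^{-p}` for `0 ≤ p ≤ c`
  (replacing the monotonicity of `g(s) = h^{-2a}(s) e^{-ρ²/16s}` in (A.2.14)–(A.2.15)),
  `e^{-r²/4s} (r + √s)^{2k} ≤ C_k s^k` (the passage to the limit `ε → 0` in (A.2.10) under the
  infinite-order vanishing (A.2.6)), and `ρⁿ e^{-cρ²} ≤ n!/cⁿ` for `ρ ≥ 1`.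

## References

* G. Seregin, *Lecture notes on regularity theory for the Navier–Stokes equations*, World
  Scientific 2014, App. A.2, Thm. 2.4, Lemma A.1, (A.2.4)–(A.2.18), pp. 210–212.
* L. Escauriaza, G. Seregin, V. Šverák, *`L_{3,∞}`-solutions of Navier–Stokes equations and
  backward uniqueness*, Russ. Math. Surveys 58:2 (2003) 211–250, §4, Thm. 4.1.
-/

noncomputable section

open MeasureTheory Set Function Filter Topology
open scoped InnerProductSpace RealInnerProductSpace Nat

namespace Literature.Analysis.FluidPDE

namespace Carleman

/-! ### Parabolic dilations `w ↦ U(λ² w.1, x₁ + λ w.2)` -/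

section Dilation

variable {E : Type*} [NormedAddCommGroup E] [InnerProductSpace ℝ E]
variable {F : Type*} [NormedAddCommGroup F] [NormedSpace ℝ F]
variable {V : ℝ × E → F} {lam : ℝ} {x₁ : E}

/-- The parabolic dilation `w ↦ (λ² w.1, x₁ + λ w.2)` has derivative `(σ, η) ↦ (λ²σ, λη)`.
[folklore] -/
theorem hasFDerivAt_parabolicDilation (lam : ℝ) (x₁ : E) (w : ℝ × E) :
    HasFDerivAt (fun w : ℝ × E => (lam ^ 2 * w.1, x₁ + lam • w.2))
      ((lam ^ 2 • ContinuousLinearMap.fst ℝ ℝ E).prod (lam • ContinuousLinearMap.snd ℝ ℝ E)) w :=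
  ((hasFDerivAt_fst (p := w)).const_mul (lam ^ 2)).prodMk
    (((hasFDerivAt_snd (p := w)).const_smul lam).const_add x₁)

/-- The parabolic dilation is smooth. [folklore] -/
theorem contDiff_parabolicDilation (lam : ℝ) (x₁ : E) {n : WithTop ℕ∞} :
    ContDiff ℝ n fun w : ℝ × E => (lam ^ 2 * w.1, x₁ + lam • w.2) :=
  (contDiff_const.mul contDiff_fst).prodMk (contDiff_const.add (contDiff_const.smul contDiff_snd))

/-- The parabolic dilation is continuous. [folklore] -/
theorem continuous_parabolicDilation (lam : ℝ) (x₁ : E) :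
    Continuous fun w : ℝ × E => (lam ^ 2 * w.1, x₁ + lam • w.2) :=
  (contDiff_parabolicDilation lam x₁ (n := 0)).continuous

/-- **Chain rule for the parabolic dilation**:
`D(U ∘ A)(w) d = DU(Aw) (λ² d.1, λ d.2)`. [folklore] -/
theorem fderiv_comp_parabolicDilation_apply {w : ℝ × E}
    (hV : DifferentiableAt ℝ V (lam ^ 2 * w.1, x₁ + lam • w.2)) (d : ℝ × E) :
    fderiv ℝ (fun w : ℝ × E => V (lam ^ 2 * w.1, x₁ + lam • w.2)) w d =
      fderiv ℝ V (lam ^ 2 * w.1, x₁ + lam • w.2) (lam ^ 2 * d.1, lam • d.2) := by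
  have h : HasFDerivAt (fun w : ℝ × E => V (lam ^ 2 * w.1, x₁ + lam • w.2))
      ((fderiv ℝ V (lam ^ 2 * w.1, x₁ + lam • w.2)).comp
        ((lam ^ 2 • ContinuousLinearMap.fst ℝ ℝ E).prod (lam • ContinuousLinearMap.snd ℝ ℝ E))) w :=
    hV.hasFDerivAt.comp w (hasFDerivAt_parabolicDilation lam x₁ w)
  rw [h.fderiv]
  simp

/-- `∂ₜ(U ∘ A)(w) = λ² ∂ₜU(Aw)` (Seregin 2014, (A.2.5): parabolic scaling of the time
derivative). [cite: Seregin2014, App. A.2 (A.2.5)] -/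
theorem dt_comp_parabolicDilation {w : ℝ × E}
    (hV : DifferentiableAt ℝ V (lam ^ 2 * w.1, x₁ + lam • w.2)) :
    dt (fun w : ℝ × E => V (lam ^ 2 * w.1, x₁ + lam • w.2)) w =
      lam ^ 2 • dt V (lam ^ 2 * w.1, x₁ + lam • w.2) := by
  rw [dt_apply, dt_apply, fderiv_comp_parabolicDilation_apply hV, ← map_smul]
  congr 1
  ext <;> simp

/-- `∂ₑ(U ∘ A)(w) = λ ∂ₑU(Aw)`. [cite: Seregin2014, App. A.2 (A.2.5)] -/
theorem dx_comp_parabolicDilation {w : ℝ × E}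
    (hV : DifferentiableAt ℝ V (lam ^ 2 * w.1, x₁ + lam • w.2)) (e : E) :
    dx e (fun w : ℝ × E => V (lam ^ 2 * w.1, x₁ + lam • w.2)) w =
      lam • dx e V (lam ^ 2 * w.1, x₁ + lam • w.2) := by
  rw [dx_apply, dx_apply, fderiv_comp_parabolicDilation_apply hV, ← map_smul]
  congr 1
  ext <;> simp

/-- `∂ₑ∂ₑ'(U ∘ A)(w) = λ² ∂ₑ∂ₑ'U(Aw)` for `U` of class `C²` on an open set containing `Aw`.
[cite: Seregin2014, App. A.2 (A.2.5)] -/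
theorem dx_dx_comp_parabolicDilation {O : Set (ℝ × E)} (hO : IsOpen O) (hV : ContDiffOn ℝ 2 V O)
    {w : ℝ × E} (hw : (lam ^ 2 * w.1, x₁ + lam • w.2) ∈ O) (e e' : E) :
    dx e (dx e' (fun w : ℝ × E => V (lam ^ 2 * w.1, x₁ + lam • w.2))) w =
      lam ^ 2 • dx e (dx e' V) (lam ^ 2 * w.1, x₁ + lam • w.2) := by
  have hpre : IsOpen ((fun w : ℝ × E => (lam ^ 2 * w.1, x₁ + lam • w.2)) ⁻¹' O) :=
    hO.preimage (continuous_parabolicDilation lam x₁)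
  have hVd : ∀ z ∈ O, DifferentiableAt ℝ V z := fun z hz =>
    (hV.differentiableOn (by norm_num)).differentiableAt (hO.mem_nhds hz)
  have hev : dx e' (fun w : ℝ × E => V (lam ^ 2 * w.1, x₁ + lam • w.2)) =ᶠ[𝓝 w]
      fun w' : ℝ × E => lam • dx e' V (lam ^ 2 * w'.1, x₁ + lam • w'.2) := by
    filter_upwards [hpre.mem_nhds hw] with w' hw'
    exact dx_comp_parabolicDilation (hVd _ hw') e'
  rw [dx_apply, hev.fderiv_eq]
  have hd1 : DifferentiableAt ℝ (dx e' V) (lam ^ 2 * w.1, x₁ + lam • w.2) :=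
    differentiableAt_dx_of_contDiffOn hO hV e' hw
  have hd2 : DifferentiableAt ℝ
      (fun w' : ℝ × E => dx e' V (lam ^ 2 * w'.1, x₁ + lam • w'.2)) w :=
    DifferentiableAt.comp (g := dx e' V) w hd1
      (hasFDerivAt_parabolicDilation lam x₁ w).differentiableAt
  rw [fderiv_fun_const_smul hd2 lam, FunLike.coe_smul, Pi.smul_apply, ← dx_apply,
    dx_comp_parabolicDilation hd1 e, smul_smul, ← sq]

/-- `Δₓ(U ∘ A)(w) = λ² ΔₓU(Aw)` for `U ∈ C²` near `Aw`. [cite: Seregin2014, App. A.2 (A.2.5)] -/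
theorem lap_comp_parabolicDilation [FiniteDimensional ℝ E] {O : Set (ℝ × E)} (hO : IsOpen O)
    (hV : ContDiffOn ℝ 2 V O) {w : ℝ × E} (hw : (lam ^ 2 * w.1, x₁ + lam • w.2) ∈ O) :
    lap (fun w : ℝ × E => V (lam ^ 2 * w.1, x₁ + lam • w.2)) w =
      lam ^ 2 • lap V (lam ^ 2 * w.1, x₁ + lam • w.2) := by
  simp only [lap, dx_dx_comp_parabolicDilation hO hV hw, Finset.smul_sum]

/-- `|∇ₓ(U ∘ A)|²(w) = λ² |∇ₓU|²(Aw)`. [cite: Seregin2014, App. A.2 (A.2.5)] -/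
theorem gradSq_comp_parabolicDilation [FiniteDimensional ℝ E] {w : ℝ × E}
    (hV : DifferentiableAt ℝ V (lam ^ 2 * w.1, x₁ + lam • w.2)) :
    gradSq (fun w : ℝ × E => V (lam ^ 2 * w.1, x₁ + lam • w.2)) w =
      lam ^ 2 * gradSq V (lam ^ 2 * w.1, x₁ + lam • w.2) := by
  simp only [gradSq, dx_comp_parabolicDilation hV, norm_smul, mul_pow, Finset.mul_sum,
    Real.norm_eq_abs, sq_abs]

/-- `U ∘ A` is `Cⁿ` on the preimage of an open set on which `U` is `Cⁿ`. [folklore] -/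
theorem contDiffOn_comp_parabolicDilation {O : Set (ℝ × E)} {n : WithTop ℕ∞}
    (hV : ContDiffOn ℝ n V O) :
    ContDiffOn ℝ n (fun w : ℝ × E => V (lam ^ 2 * w.1, x₁ + lam • w.2))
      ((fun w : ℝ × E => (lam ^ 2 * w.1, x₁ + lam • w.2)) ⁻¹' O) :=
  hV.comp (contDiff_parabolicDilation lam x₁).contDiffOn (mapsTo_preimage _ _)

/-- **Scaling of the backward heat inequality** (Seregin 2014, (A.2.5)): if
`|∂ₜU + ΔU| ≤ c (|U| + |∇U|)` at `Aw` (`c ≥ 0`, `U ∈ C²` near `Aw`) and `0 < λ ≤ 1`, then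
`v = U ∘ A` satisfies `|∂ₛv + Δv| ≤ cλ (|v| + |∇v|)` at `w`. [cite: Seregin2014, App. A.2 (A.2.5)] -/
theorem norm_dt_add_lap_comp_parabolicDilation_le [FiniteDimensional ℝ E] {O : Set (ℝ × E)}
    (hO : IsOpen O) (hV : ContDiffOn ℝ 2 V O) {c : ℝ} (hc : 0 ≤ c) (hlam : 0 < lam)
    (hlam1 : lam ≤ 1) {w : ℝ × E} (hw : (lam ^ 2 * w.1, x₁ + lam • w.2) ∈ O)
    (hineq : ‖dt V (lam ^ 2 * w.1, x₁ + lam • w.2) + lap V (lam ^ 2 * w.1, x₁ + lam • w.2)‖ ≤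
      c * (‖V (lam ^ 2 * w.1, x₁ + lam • w.2)‖ +
        Real.sqrt (gradSq V (lam ^ 2 * w.1, x₁ + lam • w.2)))) :
    ‖dt (fun w : ℝ × E => V (lam ^ 2 * w.1, x₁ + lam • w.2)) w +
        lap (fun w : ℝ × E => V (lam ^ 2 * w.1, x₁ + lam • w.2)) w‖ ≤
      c * lam * (‖V (lam ^ 2 * w.1, x₁ + lam • w.2)‖ +
        Real.sqrt (gradSq (fun w : ℝ × E => V (lam ^ 2 * w.1, x₁ + lam • w.2)) w)) := by
  have hVd : DifferentiableAt ℝ V (lam ^ 2 * w.1, x₁ + lam • w.2) :=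
    (hV.differentiableOn (by norm_num)).differentiableAt (hO.mem_nhds hw)
  set z : ℝ × E := (lam ^ 2 * w.1, x₁ + lam • w.2) with hz
  rw [dt_comp_parabolicDilation hVd, lap_comp_parabolicDilation hO hV hw,
    gradSq_comp_parabolicDilation hVd, ← smul_add, norm_smul, Real.norm_of_nonneg (sq_nonneg _),
    Real.sqrt_mul (sq_nonneg _), Real.sqrt_sq hlam.le]
  have hg : 0 ≤ Real.sqrt (gradSq V z) := Real.sqrt_nonneg _
  have hVn : 0 ≤ ‖V z‖ := norm_nonneg _
  have hlam2 : lam ^ 2 ≤ lam := by nlinarith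
  calc lam ^ 2 * ‖dt V z + lap V z‖ ≤ lam ^ 2 * (c * (‖V z‖ + Real.sqrt (gradSq V z))) := by
        gcongr
    _ = c * (lam ^ 2 * ‖V z‖) + c * lam * (lam * Real.sqrt (gradSq V z)) := by ring
    _ ≤ c * (lam * ‖V z‖) + c * lam * (lam * Real.sqrt (gradSq V z)) := by
        gcongr
    _ = c * lam * (‖V z‖ + lam * Real.sqrt (gradSq V z)) := by ring

end Dilation

/-! ### The function `h(s) = s e^{(1-s)/3}` -/

section HW

/-- `h(1) = 1`. [folklore] -/
theorem hW_one : hW 1 = 1 := by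
  simp [hW]

/-- `h` is nondecreasing on `[0, 3]` (`h'(s) = e^{(1-s)/3}(1 - s/3) ≥ 0`). [folklore] -/
theorem monotoneOn_hW : MonotoneOn hW (Icc 0 3) := by
  have hd : ∀ s, HasDerivAt hW (Real.exp ((1 - s) / 3) * (1 - s / 3)) s := hasDerivAt_hW
  refine monotoneOn_of_deriv_nonneg (convex_Icc 0 3) ?_ ?_ ?_
  · exact fun s _ => (hd s).continuousAt.continuousWithinAt
  · exact fun s _ => (hd s).differentiableAt.differentiableWithinAt
  · intro s hs
    rw [interior_Icc] at hs
    rw [(hd s).deriv]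
    exact mul_nonneg (Real.exp_pos _).le (by linarith [hs.2])

/-- `h(s) ≤ h(t)` for `0 ≤ s ≤ t ≤ 3`. [folklore] -/
theorem hW_le_hW {s t : ℝ} (hs : 0 ≤ s) (hst : s ≤ t) (ht : t ≤ 3) : hW s ≤ hW t :=
  monotoneOn_hW ⟨hs, hst.trans ht⟩ ⟨hs.trans hst, ht⟩ hst

/-- `h(s) ≤ 1` for `0 ≤ s ≤ 1`. [folklore] -/
theorem hW_le_one {s : ℝ} (hs : 0 ≤ s) (hs1 : s ≤ 1) : hW s ≤ 1 := by
  have h := hW_le_hW hs hs1 (by norm_num)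
  rwa [hW_one] at h

/-- `1 ≤ h(s)` for `1 ≤ s ≤ 3`. [folklore] -/
theorem one_le_hW {s : ℝ} (hs1 : 1 ≤ s) (hs3 : s ≤ 3) : 1 ≤ hW s := by
  have h := hW_le_hW zero_le_one hs1 hs3
  rwa [hW_one] at h

/-- `s ≤ h(s)` for `0 ≤ s ≤ 1` (`e^{(1-s)/3} ≥ 1`). [folklore] -/
theorem self_le_hW {s : ℝ} (hs : 0 ≤ s) (hs1 : s ≤ 1) : s ≤ hW s :=
  le_mul_of_one_le_right hs (Real.one_le_exp (by linarith))

/-- `h(3/2) > 1` (Seregin 2014, (A.2.13): "this is legal, since `h(3/2) > 1`";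
`e^{-1/6} ≥ 5/6`). [cite: Seregin2014, App. A.2 (A.2.13)] -/
theorem one_lt_hW_three_halves : 1 < hW (3 / 2) := by
  have h := Real.add_one_le_exp (-(1 / 6 : ℝ))
  have e : ((1 : ℝ) - 3 / 2) / 3 = -(1 / 6) := by norm_num
  rw [hW, e]
  nlinarith

/-- `h(3/2) < e`. [folklore] -/
theorem hW_three_halves_lt_exp_one : hW (3 / 2) < Real.exp 1 := by
  have h1 : Real.exp (((1 : ℝ) - 3 / 2) / 3) ≤ 1 := Real.exp_le_one_iff.2 (by norm_num)
  have h2 := Real.add_one_le_exp (1 : ℝ)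
  rw [hW]
  nlinarith [Real.exp_pos (((1 : ℝ) - 3 / 2) / 3)]

/-- `0 < log h(3/2)`. [cite: Seregin2014, App. A.2 (A.2.13)] -/
theorem log_hW_three_halves_pos : 0 < Real.log (hW (3 / 2)) :=
  Real.log_pos one_lt_hW_three_halves

/-- `log h(3/2) < 1`. [folklore] -/
theorem log_hW_three_halves_lt_one : Real.log (hW (3 / 2)) < 1 :=
  (Real.log_lt_iff_lt_exp (lt_trans zero_lt_one one_lt_hW_three_halves)).2
    hW_three_halves_lt_exp_one

end HW

/-! ### Three elementary real inequalities -/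

section Elementary

/-- **`s^{-p} e^{-c/s} ≤ e^{-p}` for `0 < s`, `0 ≤ p ≤ c`** (the supremum of the left side over
`s > 0` is `(p/ce)^p ≤ e^{-p}`; here from `log s ≥ 1 - 1/s`). This replaces the monotonicity of
`g(s) = h^{-2a}(s) e^{-ρ²/16s}` used in Seregin 2014, (A.2.14)–(A.2.15). [folklore] -/
theorem rpow_neg_mul_exp_neg_div_le {s p c : ℝ} (hs : 0 < s) (hp : 0 ≤ p) (hpc : p ≤ c) :
    s ^ (-p) * Real.exp (-c / s) ≤ Real.exp (-p) := by
  rw [Real.rpow_def_of_pos hs, ← Real.exp_add, Real.exp_le_exp]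
  have hlog : 1 - s⁻¹ ≤ Real.log s := Real.one_sub_inv_le_log_of_pos hs
  have hc : 0 ≤ c := hp.trans hpc
  have hcs : -c / s = -(c * s⁻¹) := by rw [neg_div, div_eq_mul_inv]
  rw [hcs]
  -- `p (1 - log s) ≤ c / s`
  by_cases h1 : Real.log s ≤ 1
  · have h2 : p * (1 - Real.log s) ≤ c * (1 - Real.log s) :=
      mul_le_mul_of_nonneg_right hpc (by linarith)
    have h3 : c * (1 - Real.log s) ≤ c * s⁻¹ := mul_le_mul_of_nonneg_left (by linarith) hc
    nlinarith
  · rw [not_le] at h1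
    have h4 : 0 ≤ c * s⁻¹ := mul_nonneg hc (inv_pos.2 hs).le
    nlinarith

/-- `x^k e^{-x} ≤ k!` for `x ≥ 0`. [folklore] -/
theorem pow_mul_exp_neg_le_factorial {x : ℝ} (hx : 0 ≤ x) (k : ℕ) :
    x ^ k * Real.exp (-x) ≤ k ! := by
  have h := Real.pow_div_factorial_le_exp (hx := hx) (n := k)
  have hk : (0 : ℝ) < k ! := by exact_mod_cast Nat.factorial_pos k
  rw [div_le_iff₀ hk] at h
  rw [Real.exp_neg]
  have he : 0 < Real.exp x := Real.exp_pos x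
  rw [mul_inv_le_iff₀ he]
  linarith

/-- **Infinite-order vanishing against the Gaussian**: `e^{-r²/4s} (r + √s)^{2k} ≤ C_k s^k` for
`r ≥ 0`, `s > 0`, with `C_k = 4^k (4^k k! + 1)` (used to let `ε → 0` in Seregin 2014, (A.2.10),
under (A.2.6)). [folklore] -/
theorem exp_neg_sq_div_mul_add_sqrt_pow_le (k : ℕ) (r : ℝ) {s : ℝ} (hs : 0 < s) :
    Real.exp (-r ^ 2 / (4 * s)) * (r + Real.sqrt s) ^ (2 * k) ≤
      4 ^ k * (4 ^ k * k ! + 1) * s ^ k := by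
  have hsq : Real.sqrt s ^ 2 = s := Real.sq_sqrt hs.le
  have hss : 0 ≤ Real.sqrt s := Real.sqrt_nonneg s
  set x : ℝ := r ^ 2 / (4 * s) with hx
  have hx0 : 0 ≤ x := by positivity
  have hex : 0 < Real.exp (-x) := Real.exp_pos _
  have hex1 : Real.exp (-x) ≤ 1 := Real.exp_le_one_iff.2 (by linarith)
  have hr2 : r ^ 2 = 4 * s * x := by rw [hx]; field_simp
  -- `(r + √s)² ≤ 2 r² + 2 s ≤ 4 max`
  have hsum : (r + Real.sqrt s) ^ 2 ≤ 2 * r ^ 2 + 2 * s := by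
    nlinarith [sq_nonneg (r - Real.sqrt s)]
  have hpow : (r + Real.sqrt s) ^ (2 * k) ≤ (2 * r ^ 2 + 2 * s) ^ k := by
    rw [pow_mul]
    exact pow_le_pow_left₀ (sq_nonneg _) hsum k
  -- `(2r² + 2s)^k ≤ 4^k (r^{2k} + s^k)`
  have hmax : (2 * r ^ 2 + 2 * s) ^ k ≤ 4 ^ k * ((r ^ 2) ^ k + s ^ k) := by
    rcases le_total (r ^ 2) s with h | h
    · calc (2 * r ^ 2 + 2 * s) ^ k ≤ (4 * s) ^ k :=
            pow_le_pow_left₀ (by positivity) (by linarith) k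
        _ = 4 ^ k * s ^ k := mul_pow _ _ _
        _ ≤ 4 ^ k * ((r ^ 2) ^ k + s ^ k) := by
            gcongr
            exact le_add_of_nonneg_left (by positivity)
    · calc (2 * r ^ 2 + 2 * s) ^ k ≤ (4 * r ^ 2) ^ k :=
            pow_le_pow_left₀ (by positivity) (by linarith) k
        _ = 4 ^ k * (r ^ 2) ^ k := mul_pow _ _ _
        _ ≤ 4 ^ k * ((r ^ 2) ^ k + s ^ k) := by
            gcongr
            exact le_add_of_nonneg_right (by positivity)
  -- `e^{-x} r^{2k} = (4s)^k x^k e^{-x} ≤ (4s)^k k!`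
  have hgauss : Real.exp (-x) * (r ^ 2) ^ k ≤ (4 * s) ^ k * k ! := by
    rw [hr2, mul_pow, show Real.exp (-x) * ((4 * s) ^ k * x ^ k) =
      (4 * s) ^ k * (x ^ k * Real.exp (-x)) from by ring]
    exact mul_le_mul_of_nonneg_left (pow_mul_exp_neg_le_factorial hx0 k) (by positivity)
  have hneg : -r ^ 2 / (4 * s) = -x := by rw [hx, neg_div]
  rw [hneg]
  calc Real.exp (-x) * (r + Real.sqrt s) ^ (2 * k)
      ≤ Real.exp (-x) * (4 ^ k * ((r ^ 2) ^ k + s ^ k)) :=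
        mul_le_mul_of_nonneg_left (hpow.trans hmax) hex.le
    _ = 4 ^ k * (Real.exp (-x) * (r ^ 2) ^ k) + 4 ^ k * (Real.exp (-x) * s ^ k) := by ring
    _ ≤ 4 ^ k * ((4 * s) ^ k * k !) + 4 ^ k * (1 * s ^ k) := by
        gcongr
    _ = 4 ^ k * (4 ^ k * k ! + 1) * s ^ k := by rw [mul_pow]; ring

/-- `ρⁿ e^{-cρ²} ≤ n!/cⁿ` for `ρ ≥ 1`, `c > 0`. [folklore] -/
theorem pow_mul_exp_neg_mul_sq_le (n : ℕ) {c ρ : ℝ} (hc : 0 < c) (hρ : 1 ≤ ρ) :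
    ρ ^ n * Real.exp (-(c * ρ ^ 2)) ≤ n ! / c ^ n := by
  have hx : 0 ≤ c * ρ ^ 2 := by positivity
  have h := pow_mul_exp_neg_le_factorial hx n
  have hcn : 0 < c ^ n := pow_pos hc n
  rw [le_div_iff₀ hcn]
  have hρn : ρ ^ n ≤ (ρ ^ 2) ^ n := by
    rw [← pow_mul]
    exact pow_le_pow_right₀ hρ (by omega)
  calc ρ ^ n * Real.exp (-(c * ρ ^ 2)) * c ^ n
      ≤ (ρ ^ 2) ^ n * Real.exp (-(c * ρ ^ 2)) * c ^ n := by gcongr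
    _ = (c * ρ ^ 2) ^ n * Real.exp (-(c * ρ ^ 2)) := by rw [mul_pow]; ring
    _ ≤ n ! := h

end Elementary

/-! ### Pointwise bounds for the Carleman weight `h^{-2a}(s) e^{-|y|²/4s}` -/

section Weight

variable {E : Type*} [NormedAddCommGroup E]

/-- The Carleman weight is nonnegative for `s > 0`. [folklore] -/
theorem carlemanWeight_nonneg (a : ℝ) {z : ℝ × E} (hz : 0 < z.1) : 0 ≤ carlemanWeight a z :=
  (carlemanWeight_pos a hz).le

/-- **Top region** (Seregin 2014, (A.2.11): the term `h^{-2a}(3/2)`): for `a ≥ 0` and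
`3/2 ≤ s ≤ 3`, `h^{-2a}(s) e^{-|y|²/4s} ≤ h(3/2)^{-2a} = e^{-2a log h(3/2)}`. [cite: Seregin2014, App. A.2 (A.2.11)] -/
theorem carlemanWeight_le_exp_of_three_halves_le {a : ℝ} (ha : 0 ≤ a) {z : ℝ × E}
    (hz : 3 / 2 ≤ z.1) (hz3 : z.1 ≤ 3) :
    carlemanWeight a z ≤ Real.exp (-(2 * a) * Real.log (hW (3 / 2))) := by
  have h0 : 0 < hW (3 / 2) := lt_trans zero_lt_one one_lt_hW_three_halves
  have hs : 0 < z.1 := by linarith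
  have h1 : hW z.1 ^ (-(2 * a)) ≤ hW (3 / 2) ^ (-(2 * a)) :=
    Real.rpow_le_rpow_of_nonpos h0 (hW_le_hW (by norm_num) hz hz3) (by linarith)
  have h2 : hW (3 / 2) ^ (-(2 * a)) = Real.exp (-(2 * a) * Real.log (hW (3 / 2))) := by
    rw [Real.rpow_def_of_pos h0, mul_comm]
  have h3 : Real.exp (-‖z.2‖ ^ 2 / (4 * z.1)) ≤ 1 := by
    rw [Real.exp_le_one_iff, neg_div]
    exact neg_nonpos.2 (by positivity)
  calc carlemanWeight a z = hW z.1 ^ (-(2 * a)) * Real.exp (-‖z.2‖ ^ 2 / (4 * z.1)) := rfl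
    _ ≤ hW (3 / 2) ^ (-(2 * a)) * 1 :=
        mul_le_mul h1 h3 (Real.exp_pos _).le (Real.rpow_nonneg h0.le _)
    _ = Real.exp (-(2 * a) * Real.log (hW (3 / 2))) := by rw [mul_one, h2]

/-- **Initial layer** (Seregin 2014, (A.2.10), the `ε`-term): for `a ≥ 0` and `0 < s ≤ 1`,
`h^{-2a}(s) e^{-|y|²/4s} ≤ s^{-2a} e^{-|y|²/4s}` (`h(s) ≥ s`). [cite: Seregin2014, App. A.2 (A.2.10)] -/
theorem carlemanWeight_le_rpow_mul_exp {a : ℝ} (ha : 0 ≤ a) {z : ℝ × E} (hz : 0 < z.1)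
    (hz1 : z.1 ≤ 1) :
    carlemanWeight a z ≤ z.1 ^ (-(2 * a)) * Real.exp (-‖z.2‖ ^ 2 / (4 * z.1)) := by
  have h1 : hW z.1 ^ (-(2 * a)) ≤ z.1 ^ (-(2 * a)) :=
    Real.rpow_le_rpow_of_nonpos hz (self_le_hW hz.le hz1) (by linarith)
  exact mul_le_mul_of_nonneg_right h1 (Real.exp_pos _).le

/-- **Annulus, `s ≤ 1`** (Seregin 2014, (A.2.12)–(A.2.15)): for `a ≥ 0`, `0 < s ≤ 1`,
`|y| ≥ ρ/2` and `2a ≤ ρ²/16`, `h^{-2a}(s) e^{-|y|²/4s} ≤ e^{-2a}`. [cite: Seregin2014, App. A.2 (A.2.15)] -/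
theorem carlemanWeight_le_exp_neg_of_le_one {a ρ : ℝ} (ha : 0 ≤ a) (hρ : 0 ≤ ρ)
    (haρ : 2 * a ≤ ρ ^ 2 / 16) {z : ℝ × E} (hz : 0 < z.1) (hz1 : z.1 ≤ 1)
    (hy : ρ / 2 ≤ ‖z.2‖) : carlemanWeight a z ≤ Real.exp (-(2 * a)) := by
  refine (carlemanWeight_le_rpow_mul_exp ha hz hz1).trans ?_
  have h1 : Real.exp (-‖z.2‖ ^ 2 / (4 * z.1)) ≤ Real.exp (-(ρ ^ 2 / 16) / z.1) := by
    rw [Real.exp_le_exp, neg_div, neg_div, neg_le_neg_iff, div_div,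
      div_le_div_iff₀ (by positivity) (by positivity)]
    have hy2 : (ρ / 2) ^ 2 ≤ ‖z.2‖ ^ 2 := pow_le_pow_left₀ (by positivity) hy 2
    nlinarith
  calc z.1 ^ (-(2 * a)) * Real.exp (-‖z.2‖ ^ 2 / (4 * z.1))
      ≤ z.1 ^ (-(2 * a)) * Real.exp (-(ρ ^ 2 / 16) / z.1) :=
        mul_le_mul_of_nonneg_left h1 (Real.rpow_nonneg hz.le _)
    _ ≤ Real.exp (-(2 * a)) := rpow_neg_mul_exp_neg_div_le hz (by linarith) haρ

/-- **Annulus, `1 ≤ s ≤ 7/4`**: for `a ≥ 0`, `1 ≤ s ≤ 7/4` and `|y| ≥ ρ/2`,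
`h^{-2a}(s) e^{-|y|²/4s} ≤ e^{-ρ²/28}` (`h(s) ≥ 1` there). [cite: Seregin2014, App. A.2 (A.2.12)] -/
theorem carlemanWeight_le_exp_neg_of_one_le {a ρ : ℝ} (ha : 0 ≤ a) (hρ : 0 ≤ ρ) {z : ℝ × E}
    (hz1 : 1 ≤ z.1) (hz2 : z.1 ≤ 7 / 4) (hy : ρ / 2 ≤ ‖z.2‖) :
    carlemanWeight a z ≤ Real.exp (-(ρ ^ 2 / 28)) := by
  have hs : 0 < z.1 := by linarith
  have h1 : hW z.1 ^ (-(2 * a)) ≤ 1 :=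
    Real.rpow_le_one_of_one_le_of_nonpos (one_le_hW hz1 (by linarith)) (by linarith)
  have h2 : Real.exp (-‖z.2‖ ^ 2 / (4 * z.1)) ≤ Real.exp (-(ρ ^ 2 / 28)) := by
    rw [Real.exp_le_exp, neg_div, neg_le_neg_iff, div_le_div_iff₀ (by norm_num) (by positivity)]
    have hy2 : (ρ / 2) ^ 2 ≤ ‖z.2‖ ^ 2 := pow_le_pow_left₀ (by positivity) hy 2
    nlinarith
  calc carlemanWeight a z = hW z.1 ^ (-(2 * a)) * Real.exp (-‖z.2‖ ^ 2 / (4 * z.1)) := rfl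
    _ ≤ 1 * Real.exp (-(ρ ^ 2 / 28)) :=
        mul_le_mul h1 h2 (Real.exp_pos _).le zero_le_one
    _ = Real.exp (-(ρ ^ 2 / 28)) := one_mul _

/-- **Lower bound on the inner cylinder** (Seregin 2014, (A.2.16)): for `a ≥ 0` and
`1/2 ≤ s ≤ 1`, `e^{-|y|²/2} ≤ h^{-2a}(s) e^{-|y|²/4s}` (`h(s) ≤ 1` there). [cite: Seregin2014, App. A.2 (A.2.16)] -/
theorem exp_neg_le_carlemanWeight {a : ℝ} (ha : 0 ≤ a) {z : ℝ × E} (hz : 1 / 2 ≤ z.1)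
    (hz1 : z.1 ≤ 1) : Real.exp (-(‖z.2‖ ^ 2 / 2)) ≤ carlemanWeight a z := by
  have hs : 0 < z.1 := by linarith
  have h1 : 1 ≤ hW z.1 ^ (-(2 * a)) :=
    Real.one_le_rpow_of_pos_of_le_one_of_nonpos (hW_pos hs) (hW_le_one hs.le hz1) (by linarith)
  have h2 : Real.exp (-(‖z.2‖ ^ 2 / 2)) ≤ Real.exp (-‖z.2‖ ^ 2 / (4 * z.1)) := by
    rw [Real.exp_le_exp, neg_div, neg_le_neg_iff, div_le_div_iff₀ (by positivity) (by norm_num)]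
    nlinarith [sq_nonneg ‖z.2‖]
  calc Real.exp (-(‖z.2‖ ^ 2 / 2)) = 1 * Real.exp (-(‖z.2‖ ^ 2 / 2)) := (one_mul _).symm
    _ ≤ hW z.1 ^ (-(2 * a)) * Real.exp (-‖z.2‖ ^ 2 / (4 * z.1)) :=
        mul_le_mul h1 h2 (Real.exp_pos _).le (zero_le_one.trans h1)
    _ = carlemanWeight a z := rfl

end Weight

end Carleman

end Literature.Analysis.FluidPDE
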